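import Summits.BirchSwinnertonDyer.BirchSwinnertonDyer.Theorems.ResidualThetaTransportAtTwoSignedMuVanishingAtTwoPlusSel2
import Summits.BirchSwinnertonDyer.BirchSwinnertonDyer.Theorems.ResidualThetaTransportAtTwoSignedMuSeedAtTwoPlusSplitFiniteness

/-!
# Line `pt-trivial-half` for crux `SignedMuSeedAtTwoPlus` (stmt-BirchSwinnertonDyer-21438) — crux-ideate r1 k2 (g5)

THE TRIVIAL HALF OF POITOU–TATE AT THE PRIME `(2)`, READ `μ`-EXACTLY: feed (a) "reciprocity only" of the card
`fine-plus-split`, executed as a checked line. Take `A := W` (the crux allows it). The landed split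
(`SignedMuAtTwo.FineSplit.splitFiniteness`, p596845) reduces the seed at `κ` to (F) statement (A) at every
cyclotomic `κ'` and (L) the PLUS-LOCAL HALF `PlusLocalHalf W κ` (image of `Sel⁺[2]` modulo `Sel₀` finite). This line
pays for (L) with the ANALYTIC SIBLING CRUX 21437: for a habitat⁺ curve (`¬CM`, `r_an = 0`, good supersingular at
`2`, `a₂ = 0`, `Δ_W < 0`), `Sel⁺/Sel₀ ↪ H¹_+(ℚ_{2,∞}, W[2^∞]) = E⁺ ⊗ ℚ₂/ℤ₂` EXACTLY — one prime over `2`, the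
`2^∞`-Selmer condition at `v ∤ 2` is already the strict one, and `Δ_W < 0` makes complex conjugation SWAP a
`ℤ₂`-basis of `T₂W`, so `H¹(ℝ, T₂W) = H¹(ℝ, W[2^∞]) = 0` (for `Δ_W > 0` a `2`-killed archimedean defect survives and
can carry `μ` over the totally real tower: the reason the habitat is `Δ < 0`). Its Pontryagin dual is therefore a
quotient of the plus local points module `P` (rank one, carried into `Λ` by `Col⁺` with NO `2`-power defect: K3's
points package at `m = 0`). For ANY integral global Iwasawa class `s ∈ 𝐇¹ = lim H¹(ℤ[1/2N, ζ_{2^n}], T₂W)` global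
reciprocity `Σ_w inv_w(s ∪ t) = 0` — the TRIVIAL half of Poitou–Tate: no Euler-system divisibility, no big image,
no Kolyvagin systems — makes every character of `Sel⁺/Sel₀` kill `col(s) := loc₂(s) mod E⁺`, so
`(Sel⁺/Sel₀)^∨ ↞ P/Λ·col(s) ≅ Col⁺(P)/(ξ) ≤ Λ/(ξ)`, `ξ := Col⁺(col s)`:  **`μ(X⁺) ≤ μ(X₀) + μ(ξ)`** (no freeness
of `𝐇¹` needed, unlike "ξ a generator of `𝐇¹ ≅ Λ`"). With `s = z` Kato's zeta element, INTEGRAL on the cyclotomic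
`ℤ₂`-tower (Kurihara–Otsuki 2006 p. 564: "`z_{ℚ_n} ∈ lim H¹(ℚ_n, T)` … the proofs of Kato's Thm 12.4(3), 12.5(4) can
be applied even for `p = 2` because we are working on the cyclotomic `ℤ₂`-extension"), the `μ`-EXACT explicit
reciprocity law at `2` (Otsuki 2009 Thm 3.4/3.6/4.1: `P_N` integral and `P_N(z_N) = θ_N` exactly, Néron-normalised,
`p = 2` supersingular allowed; K3 memo `G2-PORT-AT-2.md` §3: `Col⁺(col z) = u·L♭`) gives
`μ(ξ) = v₂(ϖ) + μ(Lminus)` — which is `0` EXACTLY WHEN the sibling crux 21437 (`SignedMuAnalyticAtTwoPlus`, scalar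
form `padicValRat 2 ϖ + μ(Lminus) = 0`, tree `signedMuAnalyticAtTwoPlus_iff_padicValRat_add_mu_eq_zero`) holds. So the
`μ`-part of the seed is NOT a third conjecture: seed ⟸ 21437 (S4, BY NAME) ∧ residual Conjecture A at `2` (S2,
shared with `sign-dichotomy` S4 / `fine-plus-split` / `theta-symbol-seed`) ∧ the port statement S1 ∧ published
analytic supply (S3) — and the parent `Kμ⁺ = 21437 ∧ 21438` then rests on 21437 + (F) + port. Differs from the parent
card `kato` (KATO-INT@2: the Euler-system DIVISIBILITY `char X_str ∣ ind(z)` at `2`, i.e. Kato Thm 13.4 / 12.5(4),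
printed for `p ≠ 2` under `SL₂(ℤ_p) ⊂ ρ(G_ℚ)`): only the trivial inclusion is used here; differs from `sign-dichotomy`
S2 (Kato's class used RATIONALLY, the sign chosen by a Coleman RATIO) by using `z` INTEGRALLY and one-signedly;
differs from `resolvent-elliptic-units` (the same (L) half paid with elliptic units of `k = ℚ(√Δ_W)`) by paying with
the curve's own modular symbols through 21437. BSD is not proved by any of this; `L(W,1) ≠ 0` enters only through
`ξ ≠ 0`.
-/

open WeierstrassCurve Literature.NumberTheory.EllipticCurves
open Literature.NumberTheory.EllipticCurves.Kobayashi2003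
open Literature.NumberTheory.EllipticCurves.Rank1Residual
open Literature.NumberTheory.EllipticCurves.ModularForms
open Summit.BirchSwinnertonDyer.Rank1Residual.Supersingular Summit.BirchSwinnertonDyer.Rank1Residual.X1
open Summit.BirchSwinnertonDyer.BirchSwinnertonDyer.Theses.ResidualThetaTransportAtTwo
open scoped MatrixGroups ModularForm
open CongruenceSubgroup

-- the Cruxes namespace of this sub repeats the summit name by design (D-0017 nested layout)
set_option linter.dupNamespace false

noncomputable section

namespace Summit.BirchSwinnertonDyer.BirchSwinnertonDyer.Cruxes.SignedMuSeedAtTwoPlus.PtTrivialHalf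

/-! ## Vocabulary (all over existing declarations; VERBATIM the currencies of the sibling lines) -/

/-- `Sel₀(ℚ_∞, W[2^∞])[2]` is finite (residual Conjecture A at `(W, 2)`; VERBATIM line `sign-dichotomy`). -/
def FineResidualFinite (W : WeierstrassCurve ℚ) [W.IsElliptic] (κ : ZpExtension ℚ 2) : Prop :=
  {s : W.fineSelmerInfty κ | 2 • s = 0}.Finite

/-- The PLUS-LOCAL HALF at `κ` (VERBATIM line `fine-plus-split`, whose structural stub `SplitFiniteness` is the landed
theorem `SignedMuAtTwo.FineSplit.splitFiniteness`, p596845): the image of `Sel⁺(W/ℚ_∞)[2]` in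
`H¹(ℚ_∞, W[2^∞]) / Sel₀(ℚ_∞, W[2^∞])` is finite — dually, `μ((Sel⁺/Sel₀)^∨) = 0`, the `μ`-part of the cyclic local
residue `P / Λ·col(s)`. -/
def PlusLocalHalf (W : WeierstrassCurve ℚ) [W.IsElliptic] (κ : ZpExtension ℚ 2) : Prop :=
  ((QuotientAddGroup.mk' (W.fineSelmerInfty κ)) ''
    {x : W.subgroupH1 2 κ.kerSubgroup | x ∈ signedSelmerInfty W κ 1 ∧ 2 • x = 0}).Finite

/-! ## Registered stub statements -/

/-- **S1 (size XL, research / PORT at the prime 2 — THE LEVER): FLAT ⇒ THE PLUS-LOCAL HALF, for the curve itself.**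
For a habitat⁺ curve `W` with its newform `f`, Néron scalar `ϖ` (`ϖ·Ω_W = Ω_f⁺`) and a Pollack pair at `2`: IF the
Néron-normalised flat `2`-adic `L`-function has `μ = 0` (`v₂(ϖ) + μ(Lminus) = 0` — the scalar form of the sibling
crux 21437, tree `signedMuAnalyticAtTwoPlus_iff_padicValRat_add_mu_eq_zero`), THEN at every cyclotomic `κ` the image of
`Sel⁺(W/ℚ_∞)[2]` modulo `Sel₀` is finite. Mechanism (feed (a) "reciprocity only" of card `fine-plus-split`, executed):
`Sel⁺/Sel₀ ↪ H¹_+(ℚ_{2,∞}, W[2^∞]) = E⁺ ⊗ ℚ₂/ℤ₂` EXACTLY (one prime over `2`; at `v ∤ 2` the `2^∞`-Selmer condition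
is already strict; `Δ_W < 0` ⇒ complex conjugation swaps a `ℤ₂`-basis of `T₂W`, so `H¹(ℝ, T₂W) = H¹(ℝ, W[2^∞]) = 0`);
its dual is a quotient of the plus local points module `P`, and for Kato's INTEGRAL zeta element `z ∈ 𝐇¹`
(Kurihara–Otsuki 2006 p. 564; Kato 2004 Thm 12.5/12.6 on the `ℤ₂`-tower) global reciprocity `Σ_w inv_w(z ∪ t) = 0`
(the TRIVIAL half of Poitou–Tate: no Euler-system divisibility, no big image, no Kolyvagin systems) makes every
character of `Sel⁺/Sel₀` kill `col(z)`: `(Sel⁺/Sel₀)^∨ ↞ P/Λ·col(z) ≅ Col⁺(P)/(ξ) ≤ Λ/(ξ)`, `ξ := Col⁺(col z)`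
(`Col⁺` injective on `P` with no `2`-defect: K3's points package at `m = 0`, `KummerPoint.exists_pointsPackage_two`,
memo `G2-PORT-AT-2.md` §3), whence `μ((Sel⁺/Sel₀)^∨) ≤ μ(ξ)`; and the `μ`-EXACT explicit reciprocity law
`ξ ≐ ϖ·Lminus` up to a `μ`-free factor (Otsuki 2009 Thm 3.6/4.1: `P_N(z_N) = θ_N` integrally, Néron-normalised,
`p = 2` supersingular allowed; `Λ`-adic passage = K3's port (Z3)) gives `μ(ξ) = v₂(ϖ) + μ(Lminus) = 0`.
`ξ ≠ 0` ⟸ `L(W,1) ≠ 0` (habitat). WHY IT MIGHT FAIL: a universal period-comparison constant of the ERL at `2`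
(`[φω,ω]`, Manin, Tamagawa-at-2 factors) could shift `μ(ξ)` off `v₂(ϖ) + μ(Lminus)` by a fixed non-zero integer —
the cheapest falsifier (compare Kurihara–Pollack/Otsuki `θ_N` data with the tree's F1 Néron-flatness tables on
`19a/43a/67a/73a/89b/91a`); and the integrality of `z` at `2` for residual image `GL₂(𝔽₂)` is asserted in print
(KO2006 p. 564), not re-proved — prime-uniform template: Kato 13.14 = Wuthrich 2014 Lemma 12/Thm 13 (`𝐇¹` free,
from `W(ℚ)[2] = 0`, plus the `(c,d)`-integral classes with a `μ`-free multiplier, `1 - σ₅ ≢ 0 mod 2`, give `z ∈ 𝐇¹`). -/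
def FlatPlusLocalHalfAtTwo : Prop :=
  ∀ (W : WeierstrassCurve ℚ) [W.IsElliptic] [W.IsGloballyMinimal], ¬ W.HasCM → W.analyticRank = 0 →
    GoodSS W 2 → W.frobeniusTrace 2 = 0 → W.Δ < 0 →
    ∀ [NeZero (W.conductorNorm ℤ)] (f : CuspForm (Gamma0 (W.conductorNorm ℤ)) 2), IsNewformOf W f →
    ∀ (ϖ : ℚ), (ϖ : ℝ) * W.realPeriodRat = plusPeriod f →
    ∀ (Lplus Lminus : IwasawaAlgebra 2), IsPollackPair f 2 Lplus Lminus →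
    padicValRat 2 ϖ + MuLambda.mu Lminus = 0 →
    ∀ (κ : ZpExtension ℚ 2), κ.IsCyclotomic → PlusLocalHalf W κ

/-- **S2 (research-grade uniformly, per class a class-number computation; VERBATIM `sign-dichotomy` S4 and the
common (F)-half of `fine-plus-split` / `theta-symbol-seed` / `resolvent-elliptic-units`): residual Conjecture A
at 2 on the habitat⁺** — `Sel₀(ℚ_∞, W)[2]` finite for every habitat⁺ curve and cyclotomic `κ`
(⟸ Lim 2017 Thm 3.5 at two (`Lim2017.thm35_at_two_…`) + `ℚ(W[2]) ≤ ℚ(W[4])` + `μ₂(ℚ(W[2])^{cyc}) = 0`, e.g. odd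
class number of the cubic field: 87/153 habitat⁺ classes by kit j300502). WHY IT MIGHT FAIL: a habitat⁺ class with
`μ₂(ℚ(W[2])^{cyc}) > 0` hidden behind even cubic class numbers (none known; Iwasawa's `μ = 0` conjecture). -/
def FineResidualHabitatAtTwo : Prop :=
  ∀ (W : WeierstrassCurve ℚ) [W.IsElliptic] [W.IsGloballyMinimal], ¬ W.HasCM → W.analyticRank = 0 →
    GoodSS W 2 → W.frobeniusTrace 2 = 0 → W.Δ < 0 →
    ∀ (κ : ZpExtension ℚ 2), κ.IsCyclotomic → FineResidualFinite W κ

/-- **S3 (size S–M, published inputs made explicit): ANALYTIC SUPPLY AT 2 AT LEVEL `N_W`** — a habitat curve has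
non-zero conductor norm, a newform `f` of level `Γ₀(N_W)` attached to it (modularity: Breuil–Conrad–Diamond–Taylor
2001 Thm A; route support `ModularParametrizationSupply`), a RATIONAL Néron scalar `ϖ` with `ϖ·Ω_W = Ω_f⁺`
(period lattices of isogenous curves are commensurable; Manin constant ∈ ℚ), and a Pollack pair at `p = 2`
(Pollack 2003 Thm 5.6 covers `p = 2`, `a₂ = 0`: quoted at `p = 2` by Kurihara–Otsuki 2006 Rem. 0.2(3); the tree's
`pollack_exists_plusMinusPAdicLFunction` is guarded `p ≠ 2`, so this is a literature gap made explicit, shared in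
substance with `sign-dichotomy` S5 but at the level the sibling crux 21437 quantifies over). WHY IT MIGHT FAIL:
only by a mismatch of tree conventions (`plusPeriod f` vs the Néron lattice; `IsPollackPair` normalisation at `2`). -/
def AnalyticSupplyAtTwo : Prop :=
  ∀ (W : WeierstrassCurve ℚ) [W.IsElliptic] [W.IsGloballyMinimal], GoodSS W 2 → W.frobeniusTrace 2 = 0 →
    ∃ (_ : NeZero (W.conductorNorm ℤ)) (f : CuspForm (Gamma0 (W.conductorNorm ℤ)) 2) (ϖ : ℚ)
      (Lplus Lminus : IwasawaAlgebra 2),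
      IsNewformOf W f ∧ (ϖ : ℝ) * W.realPeriodRat = plusPeriod f ∧ IsPollackPair f 2 Lplus Lminus

/-! ## The stubs (the ONLY `sorry`s of this file) -/

/-- S1 — the lever (research / port at the prime 2): FLAT ⇒ plus-local half. -/
theorem stub_flatPlusLocalHalfAtTwo : FlatPlusLocalHalfAtTwo := by
  sorry

/-- S2 — residual Conjecture A at 2 on the habitat⁺ (shared (F)-half). -/
theorem stub_fineResidualHabitatAtTwo : FineResidualHabitatAtTwo := by
  sorry

/-- S3 — modularity + rational period scalar + Pollack pair at 2, at level `N_W`. -/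
theorem stub_analyticSupplyAtTwo : AnalyticSupplyAtTwo := by
  sorry

/-- S4 — the SIBLING crux 21437 BY NAME (`SignedMuAnalyticAtTwoPlus`, r401; served, and certified per class by the
route's (G')_N / cusp-span programme). It is an INPUT of this line, not a target of it: when 21437 closes this stub
closes with it, and the parent `SignedMuVanishingAtTwoPlus` (20689 ⟺ 21437 ∧ 21438, p585569) then needs nothing else. -/
theorem stub_flatAtTwo : SignedMuAnalyticAtTwoPlus := by
  sorry

/-! ## Per-curve reduction (no sorry): FLAT-scalar + fine residual finiteness ⇒ `Sel⁺[2]` finite -/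

/-- Per curve and per `κ` (no sorry; hypothesis `h1` = S1): FLAT in scalar form for one analytic datum + the fine
residual finiteness at every cyclotomic `κ'` ⇒ `Sel⁺(W/ℚ_∞)[2]` finite (the SEL2 currency of the door p580570), via
S1 and the LANDED split `SignedMuAtTwo.FineSplit.splitFiniteness` (p596845), statement (A) being produced from
`Sel₀[2]` finite by `IwasawaModuleFinitePadicInt.exists_fineSelmerDualData_moduleFinite_iff_finite_pTorsion`. -/
theorem sel2Finite_of_flat (h1 : FlatPlusLocalHalfAtTwo) (W : WeierstrassCurve ℚ) [W.IsElliptic]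
    [W.IsGloballyMinimal] (hCM : ¬ W.HasCM) (hr : W.analyticRank = 0) (hss : GoodSS W 2)
    (ha : W.frobeniusTrace 2 = 0) (hΔ : W.Δ < 0) [NeZero (W.conductorNorm ℤ)]
    (f : CuspForm (Gamma0 (W.conductorNorm ℤ)) 2) (hf : IsNewformOf W f) (ϖ : ℚ)
    (hϖ : (ϖ : ℝ) * W.realPeriodRat = plusPeriod f) (Lplus Lminus : IwasawaAlgebra 2)
    (hP : IsPollackPair f 2 Lplus Lminus) (hflat : padicValRat 2 ϖ + MuLambda.mu Lminus = 0)
    (hF : ∀ κ' : ZpExtension ℚ 2, κ'.IsCyclotomic → FineResidualFinite W κ')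
    (κ : ZpExtension ℚ 2) (γ : Field.absoluteGaloisGroup ℚ) (hκ : κ.IsCyclotomic) (hγ : κ.IsTopGenerator γ) :
    {s : signedSelmerInfty W κ 1 | 2 • s = 0}.Finite := by
  refine Theorems.SignedMuAtTwo.FineSplit.splitFiniteness W κ γ hκ hγ (fun κ' hκ' ↦ ?_)
    (h1 W hCM hr hss ha hΔ f hf ϖ hϖ Lplus Lminus hP hflat κ hκ)
  obtain ⟨γ₀, hγ₀⟩ : ∃ γ₀ : Field.absoluteGaloisGroup ℚ, κ'.IsTopGenerator γ₀ :=
    κ'.surjective (Multiplicative.ofAdd 1)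
  exact (IwasawaModuleFinitePadicInt.exists_fineSelmerDualData_moduleFinite_iff_finite_pTorsion W κ' hγ₀).mpr
    (hF κ' hκ')

/-! ## The skeleton theorem (registrar shape: the ONLY theorem of this file concluding the crux) -/

/-- **THE SKELETON THEOREM: the crux BY NAME from the four declared stubs, glue inlined (the only `sorry`s in its
closure are `stub_flatPlusLocalHalfAtTwo`, `stub_fineResidualHabitatAtTwo`, `stub_analyticSupplyAtTwo`,
`stub_flatAtTwo`).** `A := W`, `e := AddEquiv.refl`: the analytic data `(f, ϖ, L±)` come from S3; FLAT in scalar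
form from the SIBLING CRUX 21437 (S4 = `SignedMuAnalyticAtTwoPlus` by name) through the tree's
`signedMuAnalyticAtTwoPlus_iff_padicValRat_add_mu_eq_zero`; `sel2Finite_of_flat` (S1 + S2 + the landed split p596845)
gives `Sel⁺[2]` finite; the SEL2 door `isTorsion_and_mu_eq_zero_iff_finite_selmer_pTorsion` (p580570) converts to
torsion + `μ = 0` for every finitely generated pinned plus dual `D`. READING: with S1–S3 proved, the seed crux 21438 is
a CONSEQUENCE of its analytic sibling 21437 — replacing `stub_flatAtTwo` by the route's eventual proof of
`SignedMuAnalyticAtTwoPlus` needs no other change, and the parent `Kμ⁺` (20689 ⟺ 21437 ∧ 21438, p585569) then rests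
on 21437 + residual Conjecture A at 2 + the port S1 + the supply S3. -/
theorem SignedMuSeedAtTwoPlus_of :
    Summit.BirchSwinnertonDyer.BirchSwinnertonDyer.Theses.ResidualThetaTransportAtTwo.SignedMuSeedAtTwoPlus := by
  intro W _ _ hCM hr hss ha hΔ
  refine ⟨W, ‹_›, ‹_›, hss, ha, ⟨AddEquiv.refl _, fun σ P ↦ rfl⟩, fun κ γ hκ hγ D _ ↦ ?_⟩
  obtain ⟨hN, f, ϖ, Lplus, Lminus, hf, hϖ, hP⟩ := stub_analyticSupplyAtTwo W hss ha
  have hflat : padicValRat 2 ϖ + MuLambda.mu Lminus = 0 :=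
    (Theorems.SignedMuAtTwo.signedMuAnalyticAtTwoPlus_iff_padicValRat_add_mu_eq_zero.mp stub_flatAtTwo)
      W hCM hr hss ha hΔ f hf ϖ hϖ Lplus Lminus hP
  have hfin : {s : signedSelmerInfty W κ 1 | 2 • s = 0}.Finite :=
    sel2Finite_of_flat stub_flatPlusLocalHalfAtTwo W hCM hr hss ha hΔ f hf ϖ hϖ Lplus Lminus hP hflat
      (fun κ' hκ' ↦ stub_fineResidualHabitatAtTwo W hCM hr hss ha hΔ κ' hκ') κ γ hκ hγ
  exact (Theorems.SignedMuAtTwo.isTorsion_and_mu_eq_zero_iff_finite_selmer_pTorsion D).mpr hfin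

end Summit.BirchSwinnertonDyer.BirchSwinnertonDyer.Cruxes.SignedMuSeedAtTwoPlus.PtTrivialHalf

end
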